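import Mathlib
import Summits.Ventures.PercRepro2.Defs
import Summits.Ventures.PercRepro2.Graph
import Summits.Ventures.PercRepro2.HullDefs
import Summits.Ventures.PercRepro2.LocRows
import Summits.Ventures.PercRepro2.SwRow

/-!
# The hull-of-`h` localisation of row (SW): the gadget domination (GAD) gives the weight-free base
(blind cell PercRepro2, night-4 g6, 2026-08-24; proofs/NIGHT4-G6.md §4)

For a vertex `h` and a configuration `ζ` let `H_h = C_R(h) ∪ C_B(h)` be the HULL of `h`
(`Hull.hull ends ζ h`), `K = C_R(h) ∩ C_B(h)` its core, `R_side = C_R(h) ∖ C_B(h)`,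
`B_side = C_B(h) ∖ C_R(h)`.  When `l ∉ H_h`, the red cluster of `l` never meets `C_R(h)`, and inside
the hull it can only use the RED GADGET `gadgetR` — the red edges with both ends on the blue side
of `h` and the edges leaving the hull at a blue-side vertex (those are red: `boundary_red`); likewise
its blue cluster only uses the BLUE GADGET `gadgetB = gadgetR` of the swapped colouring.  This is the
cluster identity `cluster_eq_override_gadgetR`: the red cluster of `l` in `ζ` is its red cluster in
the OVERRIDE of `ζ` which is red exactly on the gadget among the edges touching the hull.

Grouping the configurations by the DATUM of the hull of `h` (`datumH`: the colouring on the edges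
touching `H_h`, blue elsewhere) the two sides of the Hall form of row (SW) (`LocRows.sw_of_card_le`)
become sums over data of `φ_H(gadgetB)` and `φ_H(gadgetR)`, where `φ_H(Γ)` counts the outside
colourings joining `l` to `o` through the gadget `Γ` — an INCREASING function of the edge set `Γ`
(`phiH_mono`).  Row (GAD) (`GadgetDom`) is the statement that for every hull `H`, every up-set `𝓦`
of pairs `(C_R(h), C_B(h))` in the order «red cluster smaller, blue cluster larger» and every
increasing `φ`, the sum of `φ(gadgetR)` over the data with `(C_R(h), C_B(h)) ∈ 𝓦` dominates the sum
of `φ(gadgetB)`.  THEOREM `sw_of_gadgetDom`: (GAD) for the hulls not containing `l` gives row (SW).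
(GAD) mentions only `h`: the marks `l, o` and the rest of the graph enter through `φ` alone.
-/

namespace Summit.Ventures.PercRepro2

namespace HullLoc

open Hull LocRows

open scoped Classical

variable {V : Type*} {E : Type*}

section Defs

variable (ends : E → Sym2 V) [DecidableEq E]

/-- The override of `ζ` on the edges touching `H`: red exactly on `Γ` there, `ζ` elsewhere. -/
noncomputable def override (H : Set V) (Γ : Finset E) (ζ : Config E) : Config E :=
  fun e => if e ∈ touches ends H then decide (e ∈ Γ) else ζ e

/-- The datum of the hull of `h`: the colouring on the edges touching the hull, blue elsewhere. -/
noncomputable def datumH (h : V) (ζ : Config E) : Config E :=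
  fun e => if e ∈ touches ends (hull ends ζ h) then ζ e else false

variable [Fintype E]

/-- The red gadget of the hull of `h`: the red edges with both ends on the blue side of `h`, and the
edges leaving the hull at a blue-side vertex. -/
noncomputable def gadgetR (h : V) (ζ : Config E) : Finset E :=
  Finset.univ.filter fun e =>
    (e ∈ within ends (bside ends ζ h) ∧ ζ e = true) ∨
      (e ∈ touches ends (bside ends ζ h) ∧ e ∉ within ends (hull ends ζ h))

/-- The blue gadget of the hull of `h`: the blue edges with both ends on the red side of `h`, and the
edges leaving the hull at a red-side vertex. -/
noncomputable def gadgetB (h : V) (ζ : Config E) : Finset E :=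
  Finset.univ.filter fun e =>
    (e ∈ within ends (rside ends ζ h) ∧ ζ e = false) ∨
      (e ∈ touches ends (rside ends ζ h) ∧ e ∉ within ends (hull ends ζ h))

/-- The outside connection count of a gadget: the configurations that are red exactly on `Γ` among the
edges touching `H` and join `l` to `o` in red. -/
noncomputable def phiH (H : Set V) (l o : V) (Γ : Finset E) : ℕ :=
  (Finset.univ.filter fun ζ : Config E =>
    (∀ e ∈ touches ends H, ζ e = decide (e ∈ Γ)) ∧ o ∈ cluster ends ζ l).card

end Defs

/-- An up-set of pairs `(T, T')` in the order «`T` smaller, `T'` larger». -/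
def IsStatusUpper (𝓦 : Set (Set V × Set V)) : Prop :=
  ∀ p q : Set V × Set V, q.1 ⊆ p.1 → p.2 ⊆ q.2 → p ∈ 𝓦 → q ∈ 𝓦

section Gadget

variable {ends : E → Sym2 V} [Fintype E] [DecidableEq E]

omit [DecidableEq E] in
/-- Membership in the red gadget. -/
lemma mem_gadgetR {h : V} {ζ : Config E} {e : E} :
    e ∈ gadgetR ends h ζ ↔
      (e ∈ within ends (bside ends ζ h) ∧ ζ e = true) ∨
        (e ∈ touches ends (bside ends ζ h) ∧ e ∉ within ends (hull ends ζ h)) := by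
  simp [gadgetR]

omit [DecidableEq E] in
/-- Membership in the blue gadget. -/
lemma mem_gadgetB {h : V} {ζ : Config E} {e : E} :
    e ∈ gadgetB ends h ζ ↔
      (e ∈ within ends (rside ends ζ h) ∧ ζ e = false) ∨
        (e ∈ touches ends (rside ends ζ h) ∧ e ∉ within ends (hull ends ζ h)) := by
  simp [gadgetB]

omit [DecidableEq E] in
/-- The blue gadget is the red gadget of the swapped colouring. -/
lemma gadgetB_eq (h : V) (ζ : Config E) : gadgetB ends h ζ = gadgetR ends h (blue ζ) := by
  ext e
  rw [mem_gadgetB, mem_gadgetR, bside_blue, hull_blue, blue_eq_true_iff]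

omit [Fintype E] [DecidableEq E] in
/-- An edge leaving the hull at a blue-side vertex is red. -/
lemma boundary_red {h : V} {ζ : Config E} {e : E} (ht : e ∈ touches ends (bside ends ζ h))
    (hw : e ∉ within ends (hull ends ζ h)) : ζ e = true := by
  obtain ⟨x, hx, y, hends⟩ := ht
  by_contra hne
  have he : blue ζ e = true := by rw [blue_eq_true_iff]; exact Bool.eq_false_iff.2 hne
  have hy : y ∈ cluster ends (blue ζ) h := mem_cluster_of_edge hx.1 he hends
  exact hw ⟨x, Or.inr hx.1, y, Or.inr hy, hends⟩

omit [DecidableEq E] in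
/-- The red gadget consists of red edges. -/
lemma red_of_mem_gadgetR {h : V} {ζ : Config E} {e : E} (he : e ∈ gadgetR ends h ζ) : ζ e = true := by
  rw [mem_gadgetR] at he
  rcases he with ⟨_, h⟩ | ⟨ht, hw⟩
  · exact h
  · exact boundary_red ht hw

/-- The override by the red gadget is below `ζ`. -/
lemma override_gadgetR_le (h : V) (ζ : Config E) :
    override ends (hull ends ζ h) (gadgetR ends h ζ) ζ ≤ ζ := by
  intro e
  unfold override
  split_ifs with ht
  · by_cases hg : e ∈ gadgetR ends h ζ
    · rw [red_of_mem_gadgetR hg]; simp [hg]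
    · simp [hg]
  · exact le_rfl

/-- A red edge of `ζ` with both ends outside `C_R(h)` is kept by the override by the red gadget. -/
lemma override_gadgetR_of_red {h : V} {ζ : Config E} {e : E} {x y : V} (hends : ends e = s(x, y))
    (hred : ζ e = true) (hx : x ∉ cluster ends ζ h) (hy : y ∉ cluster ends ζ h) :
    override ends (hull ends ζ h) (gadgetR ends h ζ) ζ e = true := by
  unfold override
  split_ifs with ht
  · -- the edge touches the hull: an end in the hull lies on the blue side
    have side : ∀ z, z ∈ hull ends ζ h → z ∉ cluster ends ζ h → z ∈ bside ends ζ h := by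
      intro z hz hzT
      rcases hz with hz | hz
      · exact absurd hz hzT
      · exact ⟨hz, hzT⟩
    have key : e ∈ gadgetR ends h ζ := by
      rw [mem_gadgetR]
      by_cases hxH : x ∈ hull ends ζ h
      · by_cases hyH : y ∈ hull ends ζ h
        · exact Or.inl ⟨⟨x, side x hxH hx, y, side y hyH hy, hends⟩, hred⟩
        · refine Or.inr ⟨⟨x, side x hxH hx, y, hends⟩, ?_⟩
          rintro ⟨x', hx', y', hy', h'⟩
          rw [hends, Sym2.eq_iff] at h'
          rcases h' with ⟨rfl, rfl⟩ | ⟨rfl, rfl⟩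
          · exact hyH hy'
          · exact hyH hx'
      · by_cases hyH : y ∈ hull ends ζ h
        · refine Or.inr ⟨⟨y, side y hyH hy, x, ends_swap hends⟩, ?_⟩
          rintro ⟨x', hx', y', hy', h'⟩
          rw [hends, Sym2.eq_iff] at h'
          rcases h' with ⟨rfl, rfl⟩ | ⟨rfl, rfl⟩
          · exact hxH hx'
          · exact hxH hy'
        · exact absurd (mem_touches_iff_of_ends hends |>.1 ht) (by rintro (h | h) <;> contradiction)
    simp [key]
  · exact hred

/-- **The cluster identity**: for `l` outside the hull of `h`, the red cluster of `l` is its red cluster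
in the override by the red gadget — inside the hull only the red gadget is used. -/
theorem cluster_eq_override_gadgetR (h l : V) (ζ : Config E) (hl : l ∉ hull ends ζ h) :
    cluster ends ζ l = cluster ends (override ends (hull ends ζ h) (gadgetR ends h ζ) ζ) l := by
  apply Set.Subset.antisymm
  · intro u hu
    have key : u ∈ {x | x ∈ cluster ends (override ends (hull ends ζ h) (gadgetR ends h ζ) ζ) l ∧
        x ∉ cluster ends ζ h} := by
      refine mem_of_conn_of_closed (ends := ends) (ω := ζ) ?_
        ⟨mem_cluster_self _ _ _, fun h' => hl (Or.inl h')⟩ hu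
      rintro x ⟨hx₁, hx₂⟩ y hxy
      obtain ⟨_, e, he, hends⟩ := openGraph_adj.1 hxy
      have hy₂ : y ∉ cluster ends ζ h := fun hy =>
        hx₂ (mem_cluster_of_edge (ends := ends) hy he (ends_swap hends))
      refine ⟨mem_cluster_of_edge hx₁ (override_gadgetR_of_red hends he hx₂ hy₂) hends, hy₂⟩
    exact key.1
  · exact cluster_mono (override_gadgetR_le h ζ) l

end Gadget

section Datum

variable {ends : E → Sym2 V} [Fintype E] [DecidableEq E]

omit [Fintype E] [DecidableEq E] in
/-- `touches` is monotone. -/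
lemma touches_mono {S S' : Set V} (h : S ⊆ S') : touches ends S ⊆ touches ends S' :=
  fun _ ⟨x, hx, y, he⟩ => ⟨x, h hx, y, he⟩

omit [Fintype E] [DecidableEq E] in
/-- The datum agrees with `ζ` on the edges touching the hull. -/
lemma datumH_eq_of_mem {h : V} {ζ : Config E} {e : E} (he : e ∈ touches ends (hull ends ζ h)) :
    datumH ends h ζ e = ζ e := by
  simp [datumH, he]

omit [Fintype E] [DecidableEq E] in
/-- The datum is blue off the edges touching the hull. -/
lemma datumH_eq_false_of_notMem {h : V} {ζ : Config E} {e : E}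
    (he : e ∉ touches ends (hull ends ζ h)) : datumH ends h ζ e = false := by
  simp [datumH, he]

omit [Fintype E] [DecidableEq E] in
/-- The red cluster of `h` of the datum. -/
lemma cluster_datumH (h : V) (ζ : Config E) : cluster ends (datumH ends h ζ) h = cluster ends ζ h :=
  cluster_eq_of_eqOn_touches (ω := ζ) (ω' := datumH ends h ζ)
    (fun _ he => (datumH_eq_of_mem (touches_mono Set.subset_union_left he)).symm) rfl

omit [Fintype E] [DecidableEq E] in
/-- The blue cluster of `h` of the datum. -/
lemma cluster_blue_datumH (h : V) (ζ : Config E) :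
    cluster ends (blue (datumH ends h ζ)) h = cluster ends (blue ζ) h :=
  cluster_eq_of_eqOn_touches (ω := blue ζ) (ω' := blue (datumH ends h ζ))
    (fun _ he => by
      simp only [blue_apply, datumH_eq_of_mem (touches_mono Set.subset_union_right he)]) rfl

omit [Fintype E] [DecidableEq E] in
/-- The hull of the datum. -/
lemma hull_datumH (h : V) (ζ : Config E) : hull ends (datumH ends h ζ) h = hull ends ζ h := by
  simp only [hull, cluster_datumH, cluster_blue_datumH]

omit [Fintype E] [DecidableEq E] in
/-- The blue side of the datum. -/
lemma bside_datumH (h : V) (ζ : Config E) : bside ends (datumH ends h ζ) h = bside ends ζ h := by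
  simp only [bside, cluster_datumH, cluster_blue_datumH]

omit [Fintype E] [DecidableEq E] in
/-- The red side of the datum. -/
lemma rside_datumH (h : V) (ζ : Config E) : rside ends (datumH ends h ζ) h = rside ends ζ h := by
  simp only [rside, cluster_datumH, cluster_blue_datumH]

omit [Fintype E] [DecidableEq E] in
/-- The datum is idempotent. -/
lemma datumH_datumH (h : V) (ζ : Config E) : datumH ends h (datumH ends h ζ) = datumH ends h ζ := by
  funext e
  by_cases he : e ∈ touches ends (hull ends ζ h)
  · rw [datumH_eq_of_mem (by rw [hull_datumH]; exact he)]
  · rw [datumH_eq_false_of_notMem (by rw [hull_datumH]; exact he), datumH_eq_false_of_notMem he]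

omit [DecidableEq E] in
/-- The red gadget of the datum. -/
lemma gadgetR_datumH (h : V) (ζ : Config E) : gadgetR ends h (datumH ends h ζ) = gadgetR ends h ζ := by
  ext e
  rw [mem_gadgetR, mem_gadgetR, bside_datumH, hull_datumH]
  by_cases hw : e ∈ within ends (bside ends ζ h)
  · have he : e ∈ touches ends (hull ends ζ h) :=
      touches_mono (bside_subset_hull_sdiff_core ζ h |>.trans Set.sdiff_subset)
        (within_subset_touches ends _ hw)
    rw [datumH_eq_of_mem he]
  · simp [hw]

omit [DecidableEq E] in
/-- The blue gadget of the datum. -/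
lemma gadgetB_datumH (h : V) (ζ : Config E) : gadgetB ends h (datumH ends h ζ) = gadgetB ends h ζ := by
  ext e
  rw [mem_gadgetB, mem_gadgetB, rside_datumH, hull_datumH]
  by_cases hw : e ∈ within ends (rside ends ζ h)
  · have he : e ∈ touches ends (hull ends ζ h) :=
      touches_mono (rside_subset_hull_sdiff_core ζ h |>.trans Set.sdiff_subset)
        (within_subset_touches ends _ hw)
    rw [datumH_eq_of_mem he]
  · simp [hw]

omit [Fintype E] [DecidableEq E] in
/-- A configuration with datum `κ` agrees with `κ` on the edges touching the hull of `κ`. -/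
lemma agree_of_datumH_eq {h : V} {ζ κ : Config E} (hκ : datumH ends h ζ = κ) :
    ∀ e ∈ touches ends (hull ends κ h), ζ e = κ e := by
  intro e he
  have hH : hull ends κ h = hull ends ζ h := by rw [← hκ, hull_datumH]
  rw [hH] at he
  rw [← hκ, datumH_eq_of_mem he]

omit [Fintype E] [DecidableEq E] in
/-- The hull of a configuration with datum `κ` is the hull of `κ`. -/
lemma hull_eq_of_datumH_eq {h : V} {ζ κ : Config E} (hκ : datumH ends h ζ = κ) :
    hull ends ζ h = hull ends κ h := by
  rw [← hκ, hull_datumH]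

omit [Fintype E] [DecidableEq E] in
/-- A configuration agreeing with `κ` on the edges touching the hull of `κ` has the same clusters of `h`. -/
lemma clusters_of_agree {h : V} {ζ κ : Config E}
    (hag : ∀ e ∈ touches ends (hull ends κ h), ζ e = κ e) :
    cluster ends ζ h = cluster ends κ h ∧ cluster ends (blue ζ) h = cluster ends (blue κ) h :=
  ⟨cluster_eq_of_eqOn_touches (ω := κ) (ω' := ζ)
      (fun e he => (hag e (touches_mono Set.subset_union_left he)).symm) rfl,
    cluster_eq_of_eqOn_touches (ω := blue κ) (ω' := blue ζ)
      (fun e he => by simp only [blue_apply, hag e (touches_mono Set.subset_union_right he)]) rfl⟩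

omit [Fintype E] [DecidableEq E] in
/-- A configuration agreeing with a datum `κ` on the edges touching the hull of `κ` has datum `κ`. -/
lemma datumH_eq_of_agree {h : V} {ζ κ : Config E} (hκ : datumH ends h κ = κ)
    (hag : ∀ e ∈ touches ends (hull ends κ h), ζ e = κ e) : datumH ends h ζ = κ := by
  obtain ⟨h1, h2⟩ := clusters_of_agree hag
  have hH : hull ends ζ h = hull ends κ h := by simp only [hull, h1, h2]
  funext e
  by_cases he : e ∈ touches ends (hull ends κ h)
  · rw [datumH_eq_of_mem (by rw [hH]; exact he), hag e he]
  · rw [datumH_eq_false_of_notMem (by rw [hH]; exact he), ← hκ, datumH_eq_false_of_notMem he]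

end Datum

end HullLoc

end Summit.Ventures.PercRepro2
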